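import Mathlib
import HarnessLib
import HarnessLib.Audit
import Summits.AtomisticToContinuum.Statement
import Summits.AtomisticToContinuum.FouriersLaw.Theorems.EmbeddedDrudeMourreNessUnique
import Summits.AtomisticToContinuum.FouriersLaw.Theorems.FourierGreenKuboFourierFiniteResponseOfUnique
import Summits.AtomisticToContinuum.FouriersLaw.Theorems.PuiseuxTransferLedgerFiniteResponseProfile
import Summits.AtomisticToContinuum.FouriersLaw.Theorems.ContactEchoEpochsPinnedSteadyStateExists
import HarnessLib.Audit.Status.Attr

/-!
Route: TransferKernelPositivity

# Route TransferKernelPositivity — sign-regularity of the contact-to-site transfer kernel — passive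
(TP1) and monotone (TP2) response profiles make the local Ohm inequality summable, so bounded
response and Fourier's law follow

X_TP (realises idea card transfer-kernel-total-positivity-profile; second, CONFORMING filing of the
line after route TransferKernelTP was retired `not-a-thesis` because its Assembly named the
Literature decl instead of the Statement decl `FouriersLaw` — here the deciding theorem `closes`
concludes `FouriersLaw` by name, rc 0 in the planner folder). Fix pinnedChain ω₂ lam β γ (all > 0),
T > 0, the BLR protocol (T_L, T_R) = (T + δ/2, T − δ/2), δ → 0 at fixed N first; D_N = lim
totalCurrent/δ is the clause-(ii) response coefficient and θ_N(i) = lim (μ_{N,δ}(p_i²) −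
μ_{N,0}(p_i²))/δ the KINETIC-TEMPERATURE RESPONSE PROFILE. It suffices to show X_TP = (M) ∧ (P) ∧
(LO) ∧ (BRC) over the fixed-N frame: (M) MonotoneProfile — θ_N is non-increasing from the hot to the
cold side on a bulk window [ℓ, N−1−ℓ], ℓ independent of N (TP₂ / variation diminishing); (P)
Passivity — |θ_N(i)| ≤ 1/2 at every site (TP₁ / thermal passivity); (LO) LocalOhm — |D_N|/(N−1) ≤
C·Σ_{|i−x|≤ℓ'}|θ_N(i+1) − θ_N(i)| at every bulk bond (shared verbatim with the local-Ohm line,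
stmt-2738); (BRC) BoundedResponseConverges — a bounded response sequence converges to a positive
limit (import slot, stmt-2741); frame = NessUnique (0741) ∧ PinnedSteadyStateExists (9900) ∧
FiniteResponseOfUnique (0717) ∧ FiniteResponseProfile (2742), glued by two provable-now finite-sum
supports (TPGlue: P ∧ M ⇒ BVProfile with C = 2ℓ+1; BoundedResponseGlue: LO × BV ⇒ sup_N |D_N| < ∞).
The card's dictionary: by the noise-amplitude identity θ_N(i) = (γ/2T²)∫₀^∞Cov_T(p_0² − p_{N−1}²,
p_i²(t))dt the profile is a COLUMN of the kinetic-energy transfer kernel K_N(y,i) =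
∫₀^∞Cov_T(p_y²(0), p_i²(t))dt and the per-bond conductance D_N/(N−1) = γ(1/2 − θ_N(0)) =
(γ²/T²)K_N(0,N−1) is its CORNER (support ContactIdentity), so (P) is entrywise positivity (TP₁) and
(M) the 2×2-minor sign condition (TP₂) of the N×2 contact matrix [K_N(0,·), K_N(N−1,·)] — Karlin
sign-regularity of a one-dimensional transfer kernel.
Lean: `MonotoneProfile ∧ Passivity ∧ LocalOhm ∧ BoundedResponseConverges ∧ NessUnique ∧
PinnedSteadyStateExists ∧ FiniteResponseOfUnique ∧ FiniteResponseProfile`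

## Assembly
Bookkeeping, PROVED: the deciding theorem `closes (hU : NessUnique) (hEx : PinnedSteadyStateExists)
(hFR : FiniteResponseOfUnique) (hFRP : FiniteResponseProfile) (hP : Passivity) (hM :
MonotoneProfile) (hTP : TPGlue) (hLO : LocalOhm) (hBRG : BoundedResponseGlue) (hBRC :
BoundedResponseConverges) : FouriersLaw` elaborates rc 0 with the route decls in the planner folder
(SketchGlue.lean; no sorry; axioms propext, Classical.choice, Quot.sound; ≈ 70 lines). Clause (i):
PinnedSteadyStateExists + NessUnique. Clause (ii): choose the canonical steady-state family μ₀
(existence + choice, junk 0 at non-positive temperatures); FiniteResponseOfUnique gives D_N(T) along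
μ₀; TPGlue hP hM : BVProfile; BoundedResponseGlue hLO hBV hFRP bounds (|D_N|)_N;
BoundedResponseConverges gives D_N → k(T) > 0; set κ T := k(T) (T > 0, else 1); an arbitrary
steady-state family μ agrees with μ₀ at all positive temperatures (NessUnique), so its difference
quotients coincide with those of μ₀ for |δ| < 2T, i.e. eventually along 𝓝[≠]0, and the limits
transfer (Filter.Tendsto.congr'). BVProfile, ContactIdentity and Assembly are items but not
hypotheses of `closes`.

Rationale: WHY THIS LINE. One kernel carries both the profile and the current: the open-system linear-response
(noise-amplitude / Novikov) formula ∂⟨p_i²⟩/∂T_b = (γ/T²)∫₀^∞Cov(p_b²(0), p_i²(t))dt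
(KunduDharNarayan2009; ReyBellet2003 Rem 4.4; multi-terminal harmonic form DharRoy2006) and the
exact sum rule ∂_{T_L} + ∂_{T_R} = d/dT (equipartition at equal temperatures) make the
linear-response temperature profile a column of the contact-to-site transfer matrix and the
conductance its corner, so Fourier's law for the boundary-driven chain becomes a SHAPE statement
about one function. The engine imported from another area is Karlin's total positivity /
sign-regularity of one-dimensional transfer kernels (Karlin1964, Karlin1968, KarlinMcgregor1959,
GantmacherKrein2002): TP₁ = passivity (no overshoot of the bath responses), TP₂ of the N×2 contact
matrix = monotone column = monotone profile, variation diminishing ⇒ BV — the classical reason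
Green's columns and absorption probabilities of diffusions and birth–death chains are monotone,
robust to inhomogeneity and boundary conditions and needing no relaxation rate, no translation
invariance and no identification of κ. What it does that other lines do not: the local-Ohm line
(card conservation-law-rigidity-local-ohm, route LocalOhmRigidity, retired in the same sweep) files
BVProfile with no engine ('maximum-principle structure unknown'); here BVProfile is the DELIVERABLE
of two falsifiable sign statements, and the finite-N identities turn them into statements about an
equilibrium time-integrated covariance matrix that provers can attack by the cumulant split K = 2∫R²
+ ∫κ₄ (Passivity) and by Jacobi / birth–death comparison (MonotoneProfile); FourierGreenKubo needs
infinite-volume correlation decay, FeketeResistance and the junction lines never touch the profile;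
the negatives index has no FouriersLaw entry. The harmonic corner calibrates every sign: for the
conjunct's free-end pinned harmonic chain the response profile is passive AND monotone (gen-0
planner's exact Lyapunov solve, N ≤ 11, fifteen (ω₂, γ) pairs; the Rieder–Lebowitz–Lieb dip needs
wall springs), while LocalOhm is false there (flat bulk, O(1) current: HarmonicChainBallisticFlux) —
so the route cannot prove too much and all anharmonic input sits in LO.

RANKED CRUXES. #2 MonotoneProfile (crux) — [card item 3, SignRegularity₂ / TP₂] there is ℓ
(depending on ω₂, lam, β, γ, T; NOT on N) such that, under weak-NESS uniqueness, along any
steady-state family, for every N and every kinetic-temperature response profile θ_N (all difference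
quotients converging), θ_N(j) ≤ θ_N(i) whenever ℓ ≤ i ≤ j ≤ N−1−ℓ: the linear-response kinetic
temperature is non-increasing from the hot to the cold side outside boundary layers of N-independent
width. Kernel form: the far-bath column i ↦ K_N(N−1, i) is non-decreasing on the bulk window
(gambler's-ruin monotonicity = the TP₂ minor condition of [K(0,·), K(N−1,·)] given the sum rule).
Ranked 2 as the line's distinctive and most informative bet (cheapest to falsify numerically); with
Passivity it yields BVProfile (TPGlue, C = 2ℓ+1). [deps: FiniteResponseProfile] [difficulty: L] (why
it might fail: A pointwise sign with N-uniform ℓ: phonon interference over a mean free path ~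
(lam·T)⁻² may reverse single decrements where the slope is only O(1/N); harmonic NETWORKS carry heat
against the gradient (EckmannZabey2004); no comparison principle is known.) [Karlin1964,
KarlinMcgregor1959, GantmacherKrein2002, RiederLebowitzLieb1967, Nakazawa1970, EckmannZabey2004,
EckmannPilletReyBellet1999b, Dhar2008]
#3 LocalOhm (crux) — [shared verbatim with the local-Ohm line, stmt-AtomisticToContinuum-2738; card
item 4 'CornerVersusSlope' in its robust two-sided windowed form] no current without a local
kinetic-temperature gradient, uniformly in N: there are C, a window radius ℓ and an excluded
boundary width b (parameters and T, not N) such that along any steady-state family (under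
uniqueness), for every N, response coefficient d = D_N and response profile θ, at every bulk bond x
(b ≤ x ≤ N−b−2): |d|/(N−1) ≤ C·Σ_{bonds (i,i+1), |i−x|≤ℓ}|θ(i+1) − θ(i)|. Kernel form: the corner
K_N(0,N−1) is at most C × the windowed variation of the column. Engines: comparison of K_N with the
Green's function of an absorbed nearest-neighbour chain with N-uniformly elliptic rates (discrete
Harnack), or interior compactness + odd-sector rigidity (the local-Ohm card). The hardest item;
every anharmonic input of the line sits here (false at lam = β = 0). [deps: FiniteResponseOfUnique,
FiniteResponseProfile] [difficulty: open-problem] (why it might fail: It is the local Fourier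
inequality itself: no interior a-priori estimate for a pure-transport bulk is known (BLR2000 §7),
window limits may lose locality, and exactly flat bulk windows at infinitely many N (ballistic
channel, hidden conserved charge) falsify it.) [BonettoLebowitzReyBellet2000, Bernardin2014,
KunduDharNarayan2009, Karlin1964, LepriLiviPoliti2003, Dhar2008]
#4 Passivity (crux) — [card item 2, TP₁ / thermal passivity] under weak-NESS uniqueness, along any
steady-state family, for every T > 0, N, site i and every limit t of the profile difference quotient
at i: |t| ≤ 1/2 — the antisymmetric response profile lies between the bath responses ±1/2;
equivalently (sum rule a_L + a_R = 1 from ⟨p_i²⟩_{T,T} = T) 0 ≤ ∂⟨p_i²⟩/∂T_b ≤ 1 for each bath b,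
i.e. the contact rows of the transfer kernel are entrywise non-negative, (γ/T²)K_N(b,i) ∈ [0,1].
True at the harmonic corner (Isserlis: Cov(p_b², p_i²(t)) = 2Cov(p_b, p_i(t))² ≥ 0, provable from
Literature harmonicNESS in a prover's own file); attack for lam, β > 0: cumulant split K = 2∫R² +
∫κ₄ (small anharmonicity and high T first), second-order Malliavin / curvature expansion,
log-concavity of the Gibbs state. [deps: FiniteResponseProfile] [difficulty: L] (why it might fail:
Open even with self-consistent bulk noise (BLLO2009, arXiv:0809.0953 p.6: 'we expect, but are not
able to prove … T_x ∈ [T_R,T_L]'); the time-integrated connected 4-point part may out-cancel 2∫R² at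
intermediate anharmonicity, half a local period away.) [BonettoLebowitzLukkarinenOlla2009,
BonettoLebowitzLukkarinen2004, DharRoy2006, KunduDharNarayan2009, ReyBellet2003,
RiederLebowitzLieb1967]
#5 BoundedResponseConverges (crux) — [IMPORT SLOT, shared verbatim with
stmt-AtomisticToContinuum-2741; NOT this route's mechanism] under weak-NESS uniqueness, along any
steady-state family, for T > 0: if the clause-(ii) response coefficients D_N exist for all N and
(|D_N|)_N is bounded, then D_N → k for some k > 0 — 'FouriersLawFor minus bounded response', the
declared residual once boundedness is in hand; expected from the Fekete /
quasi-subadditive-resistance line (card fekete-resistance-subadditivity: R_N = N/D_N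
quasi-subadditive + Fekete ⇒ D_N → 1/ℓ, boundedness ⇒ ℓ > 0) or from FourierGreenKubo's
ThermodynamicLimit (D_N → κ_GK > 0); provers of those lines close it by citing their theorems.
[deps: FiniteResponseOfUnique] [difficulty: open-problem] (why it might fail: D_N may oscillate in N
(no monotonicity/subadditivity in the length is proved; size resonances at low T where the mean free
path exceeds N) or tend to 0 (no N-uniform lower bound on the conductance beyond μ(Φ) > 0 at fixed
N).) [BonettoLebowitzReyBellet2000, EckmannPilletReyBellet1999b, LepriLiviPoliti2003]
#9 NessUnique (support) — [shared, stmt-AtomisticToContinuum-0741] uniqueness of the weak steady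
state (class IsSteadyState: probability, ∫Lf dμ = 0 on C_c^∞, bond currents integrable) of
pinnedChain ω₂ lam β γ for all N and T_L, T_R > 0 (CEHR2018 Thm 2.13(1) for the invariant measure +
identification of weak stationary Fokker–Planck solutions with it); with PinnedSteadyStateExists it
gives clause (i) and makes the steady-state family canonical; it is the uniqueness hypothesis inside
every other item. [difficulty: M] [CuneoEckmannHairerReyBellet2018, Carmona2007]
#9 PinnedSteadyStateExists (support) — [shared, stmt-AtomisticToContinuum-9900; provable now] for
pinnedChain ω₂ lam β γ (all > 0), every N and T_L, T_R > 0 a weak steady state exists — PROVED in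
tree as Literature.MathematicalPhysics.KineticTheory.HeatConduction.pinnedChain_exists_isSteadyState
(LangevinChainNESSHolds.lean); filed as an item (one-line Theorems file) so that the route file
imports only the Statement and its cone stays free of the Langevin-SDE modules. [difficulty:
provable-now] [CuneoEckmannHairerReyBellet2018, Carmona2007]
#9 FiniteResponseOfUnique (support) — [shared, stmt-AtomisticToContinuum-0717] under weak-NESS
uniqueness, for every steady-state family, T > 0 and N, the clause-(ii) response limit D_N(T) =
lim_{δ→0, δ≠0} totalCurrent(μ N (T+δ/2) (T−δ/2))/δ exists (differentiability of the NESS at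
equilibrium, Hairer–Majda; fixed-N). [difficulty: M] [HairerMajda2009, ReyBellet2003,
CuneoEckmannHairerReyBellet2018]
#9 FiniteResponseProfile (support) — [shared, stmt-AtomisticToContinuum-2742] under weak-NESS
uniqueness, for every steady-state family, T > 0, N and site i, the profile difference quotient
(μ_{N,T+δ/2,T−δ/2}(p_i²) − μ_{N,T,T}(p_i²))/δ has a limit θ_N(i) as δ → 0, δ ≠ 0 (same
differentiability, observable p_i²; needed to instantiate θ_N in MonotoneProfile / LocalOhm /
BVProfile). [difficulty: M] [HairerMajda2009, ReyBellet2003, CuneoEckmannHairerReyBellet2018]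
#9 BVProfile (support) — [shared verbatim with stmt-AtomisticToContinuum-2740, crux 4 of the
local-Ohm line; in THIS route the DELIVERABLE of the sign-regularity engine, closed by TPGlue from
Passivity + MonotoneProfile with C = 2ℓ+1, and the robust fallback form of (M) if pointwise
monotonicity dies] under uniqueness, along any steady-state family, for T > 0 there is C with Σ_i
|θ_N(i+1) − θ_N(i)| ≤ C for every N and every response profile θ_N. Not a hypothesis of `closes`.
[difficulty: L] [RiederLebowitzLieb1967, Nakazawa1970, Dhar2008]
#9 TPGlue (support) — [provable now; finite sums] Passivity → MonotoneProfile → BVProfile: given ℓ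
from MonotoneProfile, for any N and profile θ with all limits, the bonds (i,i+1) with ℓ ≤ i, i+1 ≤
N−1−ℓ have non-negative decrements telescoping to θ(ℓ) − θ(N−1−ℓ) ≤ 1/2 + 1/2 (Passivity), and the ≤
2ℓ remaining bonds contribute |θ(i+1) − θ(i)| ≤ 1 each (Passivity), so Σ_bonds |Δθ| ≤ 2ℓ + 1 =: C.
Lean work: reindex the double indicator sum Σ_i Σ_j [j = i+1] over Fin N as a sum over i < N−1 and
telescope (Finset.sum_range_sub). [difficulty: provable-now] [Karlin1968, RiederLebowitzLieb1967]
#9 BoundedResponseGlue (support) — [provable now; finite sums — the local-to-global bookkeeping of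
the line] LocalOhm → BVProfile → FiniteResponseProfile → (under uniqueness, along any steady-state
family, for T > 0 and any sequence D of clause-(ii) response coefficients, (|D_N|)_N is bounded
above): fix C, ℓ, b from LocalOhm and C_BV from BVProfile; for N ≥ 4b+2 choose the profile θ_N by
FiniteResponseProfile, apply LocalOhm at each of the N−1−2b bulk bonds x = b, …, N−2−b and sum:
(N−1−2b)|D_N|/(N−1) ≤ C Σ_x Σ_{|i−x|≤ℓ}|Δθ_i| ≤ C(2ℓ+1) Σ_i|Δθ_i| ≤ C(2ℓ+1)C_BV, hence |D_N| ≤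
2C(2ℓ+1)C_BV; the finitely many N < 4b+2 are absorbed into the bound. Its conclusion is literally
the boundedness hypothesis of BoundedResponseConverges. [difficulty: provable-now]
[BonettoLebowitzReyBellet2000, RiederLebowitzLieb1967]
#9 ContactIdentity (support) — [theorem-grade at fixed N; 'conductance = corner'; calibration, not a
hypothesis of `closes`] under uniqueness, for N ≥ 2, if θ₀, θ₁ are the profile limits at the contact
sites 0 and N−1 and d = D_N, then d = γ(N−1)(1/2 − θ₀) = γ(N−1)(θ₁ + 1/2). Content: stationarity
applied to the contact energies h_0 = p_0²/2 + U(q_0) + ½V(q_1 − q_0) gives ⟨j_0⟩ = γ(T_L − ⟨p_0²⟩)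
(mirror identity at N−1), all bond currents agree, and μ_{N,T,T} = Gibbs gives ⟨p_0²⟩ = T at δ = 0;
needs the weak Fokker–Planck identity for polynomially growing test functions (cutoff argument with
the exponential moments of CEHR2018 Thm 2.13). It fixes every sign convention (θ_N(0) < 1/2 ⟺ D_N >
0; Passivity at the contacts ⟺ 0 ≤ D_N ≤ γ(N−1)) and is the finite-N corner formula of the card;
verified to 1e−12 on the harmonic chain by the gen-0 planner's Lyapunov solve (N ≤ 11). [difficulty:
M] [BonettoLebowitzReyBellet2000, KunduDharNarayan2009, LepriLiviPoliti2003, AokiKusnezov2001]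

TWO-LAYER PLAN. Foreseen glued splits (nothing filed now; k ≤ 3, depth 1): Passivity ⇐
ContactRowsNonneg (K_N(b,i) ≥ 0 for the two contact rows, via the cumulant split 2∫R² + ∫κ₄ ≥ 0) →
KernelIdentity (θ_N(i) = (γ/2T²)∫₀^∞∫(p_0² − p_{N−1}²)S_t(p_i²)dμ_T dt, over the Literature
interface LangevinChainSemigroup, in a Theorems file so the route cone stays minimal) → Passivity (k
= 2); MonotoneProfile ⇐ JacobiComparison (the far-bath column solves a three-term recursion with
N-uniformly positive coefficients up to a summable defect — birth–death / oscillation-matrix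
structure, GantmacherKrein2002, Karlin1964) → DiscreteMaximumPrinciple → MonotoneProfile (k = 2);
LocalOhm is split by the local-Ohm line (InteriorCompactness → OddSectorRigidityLin) if it re-opens,
else here the same way. If MonotoneProfile dies but BV survives, restate (M) as 'sign-regular with ≤
r(T) decrement reversals on the bulk window' (variation diminishing of order r), which still feeds
TPGlue with C = 2ℓ + 1 + r; BVProfile (2740) is already an item for that pivot.

KILL CRITERIA. (a) Equilibrium MD / certified numerics of the open anharmonic chain (pinnedChain 1 1
1 1, T ∈ {0.2, 1, 5}, N ∈ {32, 64, 128}): decrements of θ_N (equivalently of the column i ↦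
K_N(N−1,i)) changing sign at depth ≫ mean free path, stably in N, refute MonotoneProfile — pivot
ONCE to the finite-reversal / BV form (Two-layer plan), close `refuted:MonotoneProfile` if TV(θ_N)
itself grows with N; (b) a NEGATIVE contact-row entry (γ/T²)K_N(0,i) < 0 at a bulk site, stable in
N, refutes Passivity — restate with an excluded boundary layer only if the violation is confined to
one (one repair), else close; (c) LocalOhm refuted (flat bulk windows with O(N⁻¹) current at
infinitely many N, or a hidden conserved charge via Mazur) kills this route together with the
local-Ohm line — and a conserved charge gives ¬FouriersLaw outright; (d) BVProfile or bounded
response proved elsewhere without sign input moots cruxes 2 and 4 (close `superseded`); (e)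
NessUnique refuted kills clause (i) of the conjunct itself; (f) BoundedResponseConverges refuted
(D_N bounded but oscillating) kills every bounded-response line at once.

NOT DECOMPOSED YET. The kernel-level statements (K_N as a Literature notion over
LangevinChainSemigroup, the sum rule (γ/T²)(K_N(0,i) + K_N(N−1,i)) = 1, symmetry K(y,i) = K(i,y) by
Θ-reversibility, positive semi-definiteness as the Gram matrix of Re(−L)⁻¹, TP₂ minors,
sign-regularity of higher order, the cumulant split, the Jacobi comparison) are prover technology
below cruxes 2 and 4 and ride with `--supports Passivity|MonotoneProfile` in Theorems files (they
need Literature.MathematicalPhysics.KineticTheory.LangevinSemigroup, deliberately NOT imported by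
the route file); the harmonic calibration (HarmonicPassivity from Literature harmonicNESS: provable,
gen-0 item 4242) likewise lives in a prover's file; the T-dependence of ℓ(T), C(T), which may and
will blow up as T → 0; monotonicity INSIDE the boundary layers; the engines of the shared cruxes
LocalOhm and BoundedResponseConverges (other lines).

CHEAPEST FALSIFIER. One equilibrium trajectory of the open chain at equal bath temperatures
(pinnedChain 1 1 1 1, T = 1, N = 32 and 64, both ends thermostatted): estimate the two contact rows
i ↦ K_N(0,i), K_N(N−1,i) as plain time-integrated covariances of kinetic energies; built-in
diagnostic (γ/T²)(K_N(0,i) + K_N(N−1,i)) = 1 at every i (sum rule); the line dies if a contact row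
goes negative in the bulk (Passivity) or if i ↦ K_N(N−1,i) fails to be monotone beyond a few mean
free paths with N-stable reversals (MonotoneProfile). Not run here (no kit in the plancard budget).
Already run (gen-0 planner, exact Lyapunov solve of the harmonic corner, N ≤ 11, fifteen (ω₂, γ)
pairs): Passivity and monotonicity hold in every case, D_N = γ(N−1)(1/2 − θ_N(0)) to 1e−12, and the
RLL dip reappears exactly when wall springs are added — the integrable corner does NOT kill (P) or
(M) for this family.

NUMBERS. Harmonic corner, ω₂ = γ = 1, T_L − T_R = δ, N = 9: θ_N = (+0.3750, +0.0312, +0.0078,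
+0.0018, 0, −0.0018, …)·δ (geometric ratio ≈ 1/4), g_N → c_∞ = 0.125 = γ(1/2 − 0.375) (ballistic);
ω₂ = 0.01, γ = 1, N = 11: θ = +0.2605, +0.0082, +0.0060, +0.0039, +0.0019, 0, … (monotone, nearly
linear bulk); RLL walls k′ = 1: θ = +0.309, −0.028, −0.004, … (one reversal = the classical dip).
Anharmonic expectations (LepriLiviPoliti2003 §6, AokiKusnezov2001, Dhar2008 §2.2): monotone profiles
with contact jumps ∝ J, mean free path ℓ(T) ~ (lam·T)⁻² at low T (AokiLukkarinenSpohn2006), so ℓ in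
(M) is expected ≍ (lam·T)⁻². TPGlue constant C_BV = 2ℓ + 1; BoundedResponseGlue bound sup_N |D_N| ≤
max(2C(2ℓ'+1)C_BV, max_{N<4b+2}|D_N|). Items at open: 13 (4 cruxes, 2 of them shared by signature; 8
support, 5 shared; 1 assembly); imports: none beyond the Statement.

DEFINITION REQUESTS. (1) `transferKernel` K_N(y,i) := ∫₀^∞ Cov_{μ_T}(p_y², S_t(p_i²)) dt over
OscillatorChain + LangevinChainSemigroup (Literature/MathematicalPhysics/KineticTheory, next to
LangevinSemigroup.lean's KuboFormula), so that kernel lemmas (sum rule, symmetry, Gram positivity)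
can be filed with `--supports`; (2) a small self-contained `Matrix.IsTP2` / sign-regular-of-order-r
predicate (Mathlib has minors via Matrix.det / submatrix, no total positivity); (3) cite fact
wanted: DharRoy2006 multi-terminal formula 'local temperature = positive sum-to-one combination of
bath temperatures' for harmonic networks. None blocks the items as filed (all are typed over the
Statement's own declarations).

Novelty: Searches (2026-08-15, this planner, on top of the card's searches, its refuter novelty audit (graded
the CARD new-combination; prior art DharRoy2006 / BonettoLebowitzLukkarinen2004 /
KunduDharNarayan2009 / ReyBellet2003) and the gen-0 planner's searches): `lit search --source
crossref "total positivity variation diminishing temperature profile nonequilibrium steady state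
oscillator chain"` (12: Karlin / Schoenberg, Brown–Johnstone–MacGibbon 1981, TVD numerics — no
junction); `lit search --hybrid "monotone temperature profile anharmonic chain heat baths … proof"`
(12 textbook hits, none); `lit galaxy search --star all` ×3 ("totally positive kernel temperature
profile" 0, "variation diminishing property of the heat kernel" 0, "monotonicity of the temperature
profile" 1, a thermistor FEM paper); `lit search --source s2 "temperature profile oscillator chain
nonequilibrium steady state Langevin" --year-from 2018` (15: arXiv:2404.00615 active Rubin bath,
arXiv:2604.00777 negative differential conductivity, arXiv:2607.13953 Lu's LSI — none uses
sign-regularity); `lit frontier AtomisticToContinuum --since 2023` (30 rows; FouriersLaw-relevant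
arXiv:2310.13338 and arXiv:2604.14056 = GautamaKhodabandehlouMaesSantra2026, read pp. 1, 4, 8: exact
2×2 heat-capacity RESPONSE matrix of the boundary-driven HARMONIC chain to bath-temperature
variations, flat bulk profile — the nearest 2026 art on 'response to a bath temperature',
current-resolved not site-resolved, no positivity structure); `li  [refs: 10.1007/s10955-006-9235-3:, 10.2140/pjm.1959.9.1141, 2404.00615, 2604.00777, 2607.13953, 2310.13338, 2604.14056, 0809.4543, math-ph/0303021, doi:10.1007/s10955-006-9235-3, doi:10.2140/pjm.1959.9.1141, DharRoy2006, BonettoLebowitzLukkarinen2004, KunduDharNarayan2009, ReyBellet2003, GautamaKhodabandehlouMaesSantra2026, EckmannZabey2004, Karlin1964, KarlinMcgregor1959]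

Barriers (technique_class: total-positivity sign-regularity local-ohm bv-profile): - technique_class: total-positivity sign-regularity local-ohm bv-profile
- Literature.Barriers.AtomisticToContinuum.HasBoundedResponse: engaged, not evaded — MonotoneProfile
and Passivity are N-UNIFORM sign statements by construction (ℓ independent of N) and deliver only BV
/ no-overshoot of the PROFILE; the bound on the current comes from the N-uniform LocalOhm summed
over ~N bulk bonds (BoundedResponseGlue); fixed-N theory (CEHR2018, Hairer–Majda) enters only
through the supports NessUnique / FiniteResponse* / ContactIdentity, never as an N-dependent
constant.
- Literature.Barriers.AtomisticToContinuum.HarmonicChainBallisticFlux: consistent and used as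
calibration — at lam = β = 0 Passivity holds (provable from harmonicNESS) and MonotoneProfile holds
numerically (N ≤ 11), while LocalOhm FAILS (flat bulk, g_N → c_∞ > 0, not_hasBoundedResponse); the
route cannot prove Fourier at the integrable corner because its only anharmonic input is LocalOhm.
- Literature.Barriers.AtomisticToContinuum.BeckerMenegaki2022_gapClosing: not met — K_N is a
time-INTEGRATED covariance at fixed N (fixed-N exponential mixing only makes the integrals
converge); no relaxation rate uniform in N is claimed or used.
- Literature.Barriers.AtomisticToContinuum.LowTemperatureWeakAnharmonicity: respected — ℓ(T), C(T)
depend on T and blow up as T → 0 (mean free path ~ (lam·T)⁻²); nothing is claimed uniformly in T or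
perturbatively in (lam, β).
- Literature.Barriers.AtomisticToContinuum.Mazur1969_inequality:

History (route lifecycle, newest last):
- 2026-08-26T10:15:34Z · DORMANT — reconciler: no traction for 8.4 d (last activity item-evidence-added at 2026-08-18T00:41:32Z); parked, not closed — `ledger route dormant route-AtomisticToConti (operator:999:3881296)
- 2026-08-31T00:46:11Z · REACTIVATED (open) — reconciler: reactivated — activity statement-checked at 2026-08-30T23:27:56Z after parking at 2026-08-26T10:15:34Z (operator:999:1472741)

sub-problem: FouriersLaw · status: open · opened planner-plancard-AtomisticToContinuum-Fourier-6c9f62e6-g2-0 2026-08-15T18:47:46Z · rev 2 · ledger route-AtomisticToContinuum-TransferKernelPositivity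
GENERATED by the gate from the ledger (D-0016/17). Provers cite these decls: `theorem foo : Summit.AtomisticToContinuum.FouriersLaw.Theses.TransferKernelPositivity.<Decl> := …` in Summits/AtomisticToContinuum/FouriersLaw/Theorems/<Name>.lean.
-/

namespace Summit.AtomisticToContinuum.FouriersLaw.Theses.TransferKernelPositivity

open scoped BigOperators Topology Manifold Classical MeasureTheory ProbabilityTheory Matrix InnerProductSpace ComplexConjugate ContinuousMap
open Filter Set Function TopologicalSpace MeasureTheory

attribute [summit_statement] _root_.FouriersLaw

/-- item stmt-AtomisticToContinuum-12008 · crux · rank 2 · open · by planner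
why it might fail: A pointwise sign with N-uniform ℓ: phonon interference over a mean free path ~ (lam·T)⁻² may reverse single decrements where the slope is only O(1/N); harmonic NETWORKS carry heat against the gradient (EckmannZabey2004); no comparison principle is known.
sources: Karlin1964, KarlinMcgregor1959, GantmacherKrein2002, RiederLebowitzLieb1967, Nakazawa1970, EckmannZabey2004
[crux] [card item 3, SignRegularity₂ / TP₂] there is ℓ (depending on ω₂, lam, β, γ, T; NOT on N)
such that, under weak-NESS uniqueness, along any steady-state family, for every N and every
kinetic-temperature response profile θ_N (all difference quotients converging), θ_N(j) ≤ θ_N(i)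
whenever ℓ ≤ i ≤ j ≤ N−1−ℓ: the linear-response kinetic temperature is non-increasing from the hot
to the cold side outside boundary layers of N-independent width. Kernel form: the far-bath column i
↦ K_N(N−1, i) is non-decreasing on the bulk window (gambler's-ruin monotonicity = the TP₂ minor
condition of [K(0,·), K(N−1,·)] given the sum rule). Ranked 2 as the line's distinctive and most
informative bet (cheapest to falsify numerically); with Passivity it yields BVProfile (TPGlue, C =
2ℓ+1). [deps: FiniteResponseProfile] [difficulty: L] -/
@[route_item "route-AtomisticToContinuum-TransferKernelPositivity", crux]
def MonotoneProfile : Prop :=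
  ∀ ω₂ lam β γ : ℝ, 0 < ω₂ → 0 < lam → 0 < β → 0 < γ → (∀ (N : ℕ) (T_L T_R : ℝ), 0 < T_L → 0 < T_R → ∀ μ ν : MeasureTheory.Measure (Literature.MathematicalPhysics.KineticTheory.HeatConduction.PhaseSpace N), (Literature.MathematicalPhysics.KineticTheory.HeatConduction.pinnedChain ω₂ lam β γ).IsSteadyState N T_L T_R μ → (Literature.MathematicalPhysics.KineticTheory.HeatConduction.pinnedChain ω₂ lam β γ).IsSteadyState N T_L T_R ν → μ = ν) → ∀ μ : (N : ℕ) → ℝ → ℝ → MeasureTheory.Measure (Literature.MathematicalPhysics.KineticTheory.HeatConduction.PhaseSpace N), (∀ (N : ℕ) (T_L T_R : ℝ), 0 < T_L → 0 < T_R → (Literature.MathematicalPhysics.KineticTheory.HeatConduction.pinnedChain ω₂ lam β γ).IsSteadyState N T_L T_R (μ N T_L T_R)) → ∀ T : ℝ, 0 < T → ∃ ℓ : ℕ, ∀ (N : ℕ) (θ : Fin N → ℝ), (∀ i : Fin N, Filter.Tendsto (fun δ : ℝ => ((∫ x, (x.2 i) ^ 2 ∂(μ N (T + δ / 2) (T -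 δ / 2))) - ∫ x, (x.2 i) ^ 2 ∂(μ N T T)) / δ) (nhdsWithin 0 {(0 : ℝ)}ᶜ) (nhds (θ i))) → ∀ i j : Fin N, ℓ ≤ i.val → i.val ≤ j.val → j.val + ℓ < N → θ j ≤ θ i

/-- item stmt-AtomisticToContinuum-12009 · crux · rank 3 · open · by planner
why it might fail: It is the local Fourier inequality itself: no interior a-priori estimate for a pure-transport bulk is known (BLR2000 §7), window limits may lose locality, and exactly flat bulk windows at infinitely many N (ballistic channel, hidden conserved charge) falsify it.
sources: BonettoLebowitzReyBellet2000, Bernardin2014, KunduDharNarayan2009, Karlin1964, LepriLiviPoliti2003, Dhar2008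
[crux] [shared verbatim with the local-Ohm line, stmt-AtomisticToContinuum-2738; card item 4
'CornerVersusSlope' in its robust two-sided windowed form] no current without a local
kinetic-temperature gradient, uniformly in N: there are C, a window radius ℓ and an excluded
boundary width b (parameters and T, not N) such that along any steady-state family (under
uniqueness), for every N, response coefficient d = D_N and response profile θ, at every bulk bond x
(b ≤ x ≤ N−b−2): |d|/(N−1) ≤ C·Σ_{bonds (i,i+1), |i−x|≤ℓ}|θ(i+1) − θ(i)|. Kernel form: the corner
K_N(0,N−1) is at most C × the windowed variation of the column. Engines: comparison of K_N with the
Green's function of an absorbed nearest-neighbour chain with N-uniformly elliptic rates (discrete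
Harnack), or interior compactness + odd-sector rigidity (the local-Ohm card). The hardest item;
every anharmonic input of the line sits here (false at lam = β = 0). [deps: FiniteResponseOfUnique,
FiniteResponseProfile] [difficulty: open-problem] -/
@[route_item "route-AtomisticToContinuum-TransferKernelPositivity", crux]
def LocalOhm : Prop :=
  ∀ ω₂ lam β γ : ℝ, 0 < ω₂ → 0 < lam → 0 < β → 0 < γ → (∀ (N : ℕ) (T_L T_R : ℝ), 0 < T_L → 0 < T_R → ∀ μ ν : MeasureTheory.Measure (Literature.MathematicalPhysics.KineticTheory.HeatConduction.PhaseSpace N), (Literature.MathematicalPhysics.KineticTheory.HeatConduction.pinnedChain ω₂ lam β γ).IsSteadyState N T_L T_R μ → (Literature.MathematicalPhysics.KineticTheory.HeatConduction.pinnedChain ω₂ lam β γ).IsSteadyState N T_L T_R ν → μ = ν) → ∀ μ : (N : ℕ) → ℝ → ℝ → MeasureTheory.Measure (Literature.MathematicalPhysics.KineticTheory.HeatConduction.PhaseSpace N), (∀ (N : ℕ) (T_L T_R : ℝ), 0 < T_L → 0 < T_R → (Literature.MathematicalPhysics.KineticTheory.HeatConduction.pinnedChain ω₂ lam β γ).IsSteadyState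 N T_L T_R (μ N T_L T_R)) → ∀ T : ℝ, 0 < T → ∃ (C : ℝ) (ℓ b : ℕ), ∀ (N : ℕ) (d : ℝ) (θ : Fin N → ℝ), Filter.Tendsto (fun δ : ℝ => (Literature.MathematicalPhysics.KineticTheory.HeatConduction.pinnedChain ω₂ lam β γ).totalCurrent (μ N (T + δ / 2) (T - δ / 2)) / δ) (nhdsWithin 0 {(0 : ℝ)}ᶜ) (nhds d) → (∀ i : Fin N, Filter.Tendsto (fun δ : ℝ => ((∫ x, (x.2 i) ^ 2 ∂(μ N (T + δ / 2) (T - δ / 2))) - ∫ x, (x.2 i) ^ 2 ∂(μ N T T)) / δ) (nhdsWithin 0 {(0 : ℝ)}ᶜ) (nhds (θ i))) → ∀ x : ℕ, b ≤ x → x + b + 2 ≤ N → |d| / ((N : ℝ) - 1) ≤ C * ∑ i : Fin N, ∑ j : Fin N, (if j.val = i.val + 1 ∧ x ≤ i.val + ℓ ∧ i.val ≤ x + ℓ then |θ j - θ i| else 0)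

/-- item stmt-AtomisticToContinuum-12010 · crux · rank 4 · open · by planner
why it might fail: Open even with self-consistent bulk noise (BLLO2009, arXiv:0809.0953 p.6: 'we expect, but are not able to prove … T_x ∈ [T_R,T_L]'); the time-integrated connected 4-point part may out-cancel 2∫R² at intermediate anharmonicity, half a local period away.
sources: BonettoLebowitzLukkarinenOlla2009, BonettoLebowitzLukkarinen2004, DharRoy2006, KunduDharNarayan2009, ReyBellet2003, RiederLebowitzLieb1967
[crux] [card item 2, TP₁ / thermal passivity] under weak-NESS uniqueness, along any steady-state
family, for every T > 0, N, site i and every limit t of the profile difference quotient at i: |t| ≤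
1/2 — the antisymmetric response profile lies between the bath responses ±1/2; equivalently (sum
rule a_L + a_R = 1 from ⟨p_i²⟩_{T,T} = T) 0 ≤ ∂⟨p_i²⟩/∂T_b ≤ 1 for each bath b, i.e. the contact
rows of the transfer kernel are entrywise non-negative, (γ/T²)K_N(b,i) ∈ [0,1]. True at the harmonic
corner (Isserlis: Cov(p_b², p_i²(t)) = 2Cov(p_b, p_i(t))² ≥ 0, provable from Literature harmonicNESS
in a prover's own file); attack for lam, β > 0: cumulant split K = 2∫R² + ∫κ₄ (small anharmonicity
and high T first), second-order Malliavin / curvature expansion, log-concavity of the Gibbs state.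
[deps: FiniteResponseProfile] [difficulty: L] -/
@[route_item "route-AtomisticToContinuum-TransferKernelPositivity", crux]
def Passivity : Prop :=
  ∀ ω₂ lam β γ : ℝ, 0 < ω₂ → 0 < lam → 0 < β → 0 < γ → (∀ (N : ℕ) (T_L T_R : ℝ), 0 < T_L → 0 < T_R → ∀ μ ν : MeasureTheory.Measure (Literature.MathematicalPhysics.KineticTheory.HeatConduction.PhaseSpace N), (Literature.MathematicalPhysics.KineticTheory.HeatConduction.pinnedChain ω₂ lam β γ).IsSteadyState N T_L T_R μ → (Literature.MathematicalPhysics.KineticTheory.HeatConduction.pinnedChain ω₂ lam β γ).IsSteadyState N T_L T_R ν → μ = ν) → ∀ μ : (N : ℕ) → ℝ → ℝ → MeasureTheory.Measure (Literature.MathematicalPhysics.KineticTheory.HeatConduction.PhaseSpace N), (∀ (N : ℕ) (T_L T_R : ℝ), 0 < T_L → 0 < T_R → (Literature.MathematicalPhysics.KineticTheory.HeatConduction.pinnedChain ω₂ lam β γ).IsSteadyState N T_L T_R (μ N T_L T_R)) → ∀ T : ℝ, 0 < T → ∀ (N : ℕ) (i : Fin N) (t : ℝ), Filter.Tendsto (fun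 δ : ℝ => ((∫ x, (x.2 i) ^ 2 ∂(μ N (T + δ / 2) (T - δ / 2))) - ∫ x, (x.2 i) ^ 2 ∂(μ N T T)) / δ) (nhdsWithin 0 {(0 : ℝ)}ᶜ) (nhds t) → |t| ≤ 1 / 2

/-- item stmt-AtomisticToContinuum-9141 · crux · rank 5 · open · by planner
why it might fail: D_N may oscillate in N (no monotonicity/subadditivity in the length is proved; size resonances at low T where the mean free path exceeds N) or tend to 0 (no N-uniform lower bound on the conductance beyond μ(Φ) > 0 at fixed N).
sources: BonettoLebowitzReyBellet2000, EckmannPilletReyBellet1999b, LepriLiviPoliti2003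
[crux] IMPORT SLOT (verbatim stmt-AtomisticToContinuum-2741 of route LocalOhmRigidity; dedup
attaches this route): under uniqueness, along any steady-state family and T > 0, if the response
coefficients D_N of clause (ii) exist and (|D_N|) is bounded then D_N → k for some k > 0.
'FouriersLawFor minus HasBoundedResponse'; expected from FeketeResistance
(QuasiSubadditiveResistance + PositiveConductance + FeketeGlue) or FourierGreenKubo's
ThermodynamicLimit — NOT this route's mechanism, declared residual once HasBoundedResponse is in
hand. [difficulty: L] -/
@[route_item "route-AtomisticToContinuum-TransferKernelPositivity", crux]
def BoundedResponseConverges : Prop :=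
  ∀ ω₂ lam β γ : ℝ, 0 < ω₂ → 0 < lam → 0 < β → 0 < γ → (∀ (N : ℕ) (T_L T_R : ℝ), 0 < T_L → 0 < T_R → ∀ μ ν : MeasureTheory.Measure (Literature.MathematicalPhysics.KineticTheory.HeatConduction.PhaseSpace N), (Literature.MathematicalPhysics.KineticTheory.HeatConduction.pinnedChain ω₂ lam β γ).IsSteadyState N T_L T_R μ → (Literature.MathematicalPhysics.KineticTheory.HeatConduction.pinnedChain ω₂ lam β γ).IsSteadyState N T_L T_R ν → μ = ν) → ∀ μ : (N : ℕ) → ℝ → ℝ → MeasureTheory.Measure (Literature.MathematicalPhysics.KineticTheory.HeatConduction.PhaseSpace N), (∀ (N : ℕ) (T_L T_R : ℝ), 0 < T_L → 0 < T_R → (Literature.MathematicalPhysics.KineticTheory.HeatConduction.pinnedChain ω₂ lam β γ).IsSteadyState N T_L T_R (μ N T_L T_R)) → ∀ T : ℝ, 0 < T → ∀ D : ℕ → ℝ, (∀ N : ℕ, Filter.Tendsto (fun δ : ℝ => (Literature.MathematicalPhysics.KineticTheory.HeatConduction.pinnedChain ω₂ lam β γ).totalCurrent (μ N (T + δ / 2)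 (T - δ / 2)) / δ) (nhdsWithin 0 {(0 : ℝ)}ᶜ) (nhds (D N))) → BddAbove (Set.range fun N => |D N|) → ∃ k : ℝ, 0 < k ∧ Filter.Tendsto D Filter.atTop (nhds k)

/-- item stmt-AtomisticToContinuum-0717 · support · rank 9 · closed · proved by Summit.AtomisticToContinuum.FouriersLaw.Theorems.FourierGreenKubo.finiteResponseOfUnique_holds (prover) · by planner
sources: HairerMajda2009, ReyBellet2003, CuneoEckmannHairerReyBellet2018
CONDITIONAL FORM OF 0705 (supersedes it as the prover target; refuters pool-5/g3-0: 0705 stand-alone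
quantifies over EVERY steady-state family and is false-prone if weak steady states were non-unique):
assuming UNIQUENESS of weak steady states (IsSteadyState class) for pinnedChain at all N, T_L, T_R >
0, the finite-N linear-response limit D_N(T) = lim_{δ→0, δ≠0} totalCurrent(μ_{N,T+δ/2,T−δ/2})/δ
exists for every T > 0 and N. Content: differentiability at equilibrium of NESS expectations of the
polynomial currents in the bath temperatures (ReyBellet2003 arXiv:math-ph/0303021 Rem 4.4 (51)–(56)
finite-volume Green–Kubo; HairerMajda2009 arXiv:0909.4313 Thm 2.3 framework — their SDE Thm 4.4
Assumption 5 fails here, so verify Assumptions 1–3 via CEHR2018 (2.5)/Carmona2007 Thm 1.1(iv)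
weighted spectral gap). N = 0, 1: totalCurrent ≡ 0, D = 0. Together with 0706 gives 0705. -/
@[route_item "route-AtomisticToContinuum-TransferKernelPositivity", crux]
def FiniteResponseOfUnique : Prop :=
  ∀ ω₂ lam β γ : ℝ, 0 < ω₂ → 0 < lam → 0 < β → 0 < γ → (∀ (N : ℕ) (T_L T_R : ℝ), 0 < T_L → 0 < T_R → ∀ μ ν : MeasureTheory.Measure (Literature.MathematicalPhysics.KineticTheory.HeatConduction.PhaseSpace N), (Literature.MathematicalPhysics.KineticTheory.HeatConduction.pinnedChain ω₂ lam β γ).IsSteadyState N T_L T_R μ → (Literature.MathematicalPhysics.KineticTheory.HeatConduction.pinnedChain ω₂ lam β γ).IsSteadyState N T_L T_R ν → μ = ν) → ∀ μ : (N : ℕ) → ℝ → ℝ → MeasureTheory.Measure (Literature.MathematicalPhysics.KineticTheory.HeatConduction.PhaseSpace N), (∀ (N : ℕ) (T_L T_R : ℝ), 0 < T_L → 0 < T_R → (Literature.MathematicalPhysics.KineticTheory.HeatConduction.pinnedChain ω₂ lam β γ).IsSteadyState N T_L T_R (μ N T_L T_R)) → ∀ T : ℝ, 0 < T → ∀ N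 : ℕ, ∃ D : ℝ, Filter.Tendsto (fun δ : ℝ => (Literature.MathematicalPhysics.KineticTheory.HeatConduction.pinnedChain ω₂ lam β γ).totalCurrent (μ N (T + δ / 2) (T - δ / 2)) / δ) (nhdsWithin 0 {(0 : ℝ)}ᶜ) (nhds D)

/-- `FiniteResponseOfUnique` holds: proved by `Summit.AtomisticToContinuum.FouriersLaw.Theorems.FourierGreenKubo.finiteResponseOfUnique_holds`. -/
theorem FiniteResponseOfUnique_holds : FiniteResponseOfUnique := _root_.Summit.AtomisticToContinuum.FouriersLaw.Theorems.FourierGreenKubo.finiteResponseOfUnique_holds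

/-- item stmt-AtomisticToContinuum-0741 · support · rank 9 · closed · proved by Summit.AtomisticToContinuum.FouriersLaw.Theorems.nessUnique_proof (prover) · by planner
sources: CuneoEckmannHairerReyBellet2018, Carmona2007
[crux] UNIQUENESS OF THE WEAK STEADY STATE (the half of stmt-0706 not covered by the landed fact
Literature.MathematicalPhysics.KineticTheory.HeatConduction.CuneoEckmannHairerReyBellet2018_pinnedChain,
p3544): for pinnedChain ω₂ lam β γ (all > 0), every N and T_L, T_R > 0, any two measures in the weak
Fokker–Planck class IsSteadyState (probability, ∫ L f dμ = 0 for f ∈ C_c^∞, bond currents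
integrable) coincide. Print: uniqueness of the INVARIANT MEASURE of the Langevin semigroup
(CuneoEckmannHairerReyBellet2018 Thm 2.13(1): C1, C2, CA; Carmona2007 Thm 1.1(iii)); the item
additionally needs 'weak stationary probability solution of L*μ = 0 ⇒ P_t-invariant' for this
hypoelliptic L with cubic drift (Echeverría 1982 well-posed martingale problem on C_c^∞ +
non-explosion via e^{θH}; Bogachev–Krylov–Röckner–Shaposhnikov 2015 Ch. 5 is non-degenerate only) —
the FP-identification lemma is the formal crux. N = 0: PhaseSpace 0 is a point (unique probability
measure); N = 1: both baths on site 0, OU at temperature (T_L+T_R)/2. This is exactly the hypothesis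
of FiniteResponse and ThermodynamicLimit and, with the fact, gives clause (i) of FouriersLawFor. -/
@[route_item "route-AtomisticToContinuum-TransferKernelPositivity", crux]
def NessUnique : Prop :=
  ∀ ω₂ lam β γ : ℝ, 0 < ω₂ → 0 < lam → 0 < β → 0 < γ → ∀ (N : ℕ) (T_L T_R : ℝ), 0 < T_L → 0 < T_R → ∀ μ ν : MeasureTheory.Measure (Literature.MathematicalPhysics.KineticTheory.HeatConduction.PhaseSpace N), (Literature.MathematicalPhysics.KineticTheory.HeatConduction.pinnedChain ω₂ lam β γ).IsSteadyState N T_L T_R μ → (Literature.MathematicalPhysics.KineticTheory.HeatConduction.pinnedChain ω₂ lam β γ).IsSteadyState N T_L T_R ν → μ = ν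

/-- `NessUnique` holds: proved by `Summit.AtomisticToContinuum.FouriersLaw.Theorems.nessUnique_proof`. -/
theorem NessUnique_holds : NessUnique := _root_.Summit.AtomisticToContinuum.FouriersLaw.Theorems.nessUnique_proof

/-- item stmt-AtomisticToContinuum-12011 · support · rank 9 · closed · proved by Summit.AtomisticToContinuum.FouriersLaw.Theorems.PuiseuxTransferLedgerFiniteResponseProfile.finiteResponseProfile_proof (prover) · by planner
sources: HairerMajda2009, ReyBellet2003, CuneoEckmannHairerReyBellet2018
[support] [shared, stmt-AtomisticToContinuum-2742] under weak-NESS uniqueness, for every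
steady-state family, T > 0, N and site i, the profile difference quotient (μ_{N,T+δ/2,T−δ/2}(p_i²) −
μ_{N,T,T}(p_i²))/δ has a limit θ_N(i) as δ → 0, δ ≠ 0 (same differentiability, observable p_i²;
needed to instantiate θ_N in MonotoneProfile / LocalOhm / BVProfile). [difficulty: M] -/
@[route_item "route-AtomisticToContinuum-TransferKernelPositivity", crux]
def FiniteResponseProfile : Prop :=
  ∀ ω₂ lam β γ : ℝ, 0 < ω₂ → 0 < lam → 0 < β → 0 < γ → (∀ (N : ℕ) (T_L T_R : ℝ), 0 < T_L → 0 < T_R → ∀ μ ν : MeasureTheory.Measure (Literature.MathematicalPhysics.KineticTheory.HeatConduction.PhaseSpace N), (Literature.MathematicalPhysics.KineticTheory.HeatConduction.pinnedChain ω₂ lam β γ).IsSteadyState N T_L T_R μ → (Literature.MathematicalPhysics.KineticTheory.HeatConduction.pinnedChain ω₂ lam β γ).IsSteadyState N T_L T_R ν → μ = ν) → ∀ μ : (N : ℕ) → ℝ → ℝ → MeasureTheory.Measure (Literature.MathematicalPhysics.KineticTheory.HeatConduction.PhaseSpace N), (∀ (N : ℕ) (T_L T_R : ℝ), 0 < T_L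 → 0 < T_R → (Literature.MathematicalPhysics.KineticTheory.HeatConduction.pinnedChain ω₂ lam β γ).IsSteadyState N T_L T_R (μ N T_L T_R)) → ∀ T : ℝ, 0 < T → ∀ (N : ℕ) (i : Fin N), ∃ t : ℝ, Filter.Tendsto (fun δ : ℝ => ((∫ x, (x.2 i) ^ 2 ∂(μ N (T + δ / 2) (T - δ / 2))) - ∫ x, (x.2 i) ^ 2 ∂(μ N T T)) / δ) (nhdsWithin 0 {(0 : ℝ)}ᶜ) (nhds t)

/-- `FiniteResponseProfile` holds: proved by `Summit.AtomisticToContinuum.FouriersLaw.Theorems.PuiseuxTransferLedgerFiniteResponseProfile.finiteResponseProfile_proof`. -/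
theorem FiniteResponseProfile_holds : FiniteResponseProfile := _root_.Summit.AtomisticToContinuum.FouriersLaw.Theorems.PuiseuxTransferLedgerFiniteResponseProfile.finiteResponseProfile_proof

/-- item stmt-AtomisticToContinuum-12012 · support · rank 9 · open · by planner
sources: RiederLebowitzLieb1967, Nakazawa1970, Dhar2008
[support] [shared verbatim with stmt-AtomisticToContinuum-2740, crux 4 of the local-Ohm line; in
THIS route the DELIVERABLE of the sign-regularity engine, closed by TPGlue from Passivity +
MonotoneProfile with C = 2ℓ+1, and the robust fallback form of (M) if pointwise monotonicity dies]
under uniqueness, along any steady-state family, for T > 0 there is C with Σ_i |θ_N(i+1) − θ_N(i)| ≤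
C for every N and every response profile θ_N. Not a hypothesis of `closes`. [difficulty: L] -/
@[route_item "route-AtomisticToContinuum-TransferKernelPositivity"]
def BVProfile : Prop :=
  ∀ ω₂ lam β γ : ℝ, 0 < ω₂ → 0 < lam → 0 < β → 0 < γ → (∀ (N : ℕ) (T_L T_R : ℝ), 0 < T_L → 0 < T_R → ∀ μ ν : MeasureTheory.Measure (Literature.MathematicalPhysics.KineticTheory.HeatConduction.PhaseSpace N), (Literature.MathematicalPhysics.KineticTheory.HeatConduction.pinnedChain ω₂ lam β γ).IsSteadyState N T_L T_R μ → (Literature.MathematicalPhysics.KineticTheory.HeatConduction.pinnedChain ω₂ lam β γ).IsSteadyState N T_L T_R ν → μ = ν) → ∀ μ : (N : ℕ) → ℝ → ℝ → MeasureTheory.Measure (Literature.MathematicalPhysics.KineticTheory.HeatConduction.PhaseSpace N), (∀ (N : ℕ) (T_L T_R : ℝ), 0 < T_L → 0 < T_R → (Literature.MathematicalPhysics.KineticTheory.HeatConduction.pinnedChain ω₂ lam β γ).IsSteadyState N T_L T_R (μ N T_L T_R)) → ∀ T : ℝ, 0 < T → ∃ C : ℝ, ∀ (N : ℕ) (θ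 : Fin N → ℝ), (∀ i : Fin N, Filter.Tendsto (fun δ : ℝ => ((∫ x, (x.2 i) ^ 2 ∂(μ N (T + δ / 2) (T - δ / 2))) - ∫ x, (x.2 i) ^ 2 ∂(μ N T T)) / δ) (nhdsWithin 0 {(0 : ℝ)}ᶜ) (nhds (θ i))) → ∑ i : Fin N, ∑ j : Fin N, (if j.val = i.val + 1 then |θ j - θ i| else 0) ≤ C

/-- item stmt-AtomisticToContinuum-12013 · support · rank 9 · closed · proved by Summit.AtomisticToContinuum.FouriersLaw.Theorems.tpGlue_proof @ 41697722dadc (prover) · by planner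
sources: Karlin1968, RiederLebowitzLieb1967
[support] [provable now; finite sums] Passivity → MonotoneProfile → BVProfile: given ℓ from
MonotoneProfile, for any N and profile θ with all limits, the bonds (i,i+1) with ℓ ≤ i, i+1 ≤ N−1−ℓ
have non-negative decrements telescoping to θ(ℓ) − θ(N−1−ℓ) ≤ 1/2 + 1/2 (Passivity), and the ≤ 2ℓ
remaining bonds contribute |θ(i+1) − θ(i)| ≤ 1 each (Passivity), so Σ_bonds |Δθ| ≤ 2ℓ + 1 =: C. Lean
work: reindex the double indicator sum Σ_i Σ_j [j = i+1] over Fin N as a sum over i < N−1 and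
telescope (Finset.sum_range_sub). [difficulty: provable-now] -/
@[route_item "route-AtomisticToContinuum-TransferKernelPositivity", crux]
def TPGlue : Prop :=
  Passivity → MonotoneProfile → BVProfile

-- `TPGlue` holds: proved by `Summit.AtomisticToContinuum.FouriersLaw.Theorems.tpGlue_proof` @ 41697722dadc (its module imports this route file, so no `_holds` link can be stated here).

/-- item stmt-AtomisticToContinuum-12014 · support · rank 9 · closed · proved by Summit.AtomisticToContinuum.FouriersLaw.Theorems.boundedResponseGlue_proof @ 41697722dadc (prover) · by planner
sources: BonettoLebowitzReyBellet2000, RiederLebowitzLieb1967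
[support] [provable now; finite sums — the local-to-global bookkeeping of the line] LocalOhm →
BVProfile → FiniteResponseProfile → (under uniqueness, along any steady-state family, for T > 0 and
any sequence D of clause-(ii) response coefficients, (|D_N|)_N is bounded above): fix C, ℓ, b from
LocalOhm and C_BV from BVProfile; for N ≥ 4b+2 choose the profile θ_N by FiniteResponseProfile,
apply LocalOhm at each of the N−1−2b bulk bonds x = b, …, N−2−b and sum: (N−1−2b)|D_N|/(N−1) ≤ C Σ_x
Σ_{|i−x|≤ℓ}|Δθ_i| ≤ C(2ℓ+1) Σ_i|Δθ_i| ≤ C(2ℓ+1)C_BV, hence |D_N| ≤ 2C(2ℓ+1)C_BV; the finitely many N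
< 4b+2 are absorbed into the bound. Its conclusion is literally the boundedness hypothesis of
BoundedResponseConverges. [difficulty: provable-now] -/
@[route_item "route-AtomisticToContinuum-TransferKernelPositivity", crux]
def BoundedResponseGlue : Prop :=
  LocalOhm → BVProfile → FiniteResponseProfile → ∀ ω₂ lam β γ : ℝ, 0 < ω₂ → 0 < lam → 0 < β → 0 < γ → (∀ (N : ℕ) (T_L T_R : ℝ), 0 < T_L → 0 < T_R → ∀ μ ν : MeasureTheory.Measure (Literature.MathematicalPhysics.KineticTheory.HeatConduction.PhaseSpace N), (Literature.MathematicalPhysics.KineticTheory.HeatConduction.pinnedChain ω₂ lam β γ).IsSteadyState N T_L T_R μ → (Literature.MathematicalPhysics.KineticTheory.HeatConduction.pinnedChain ω₂ lam β γ).IsSteadyState N T_L T_R ν → μ = ν) → ∀ μ : (N : ℕ) → ℝ → ℝ → MeasureTheory.Measure (Literature.MathematicalPhysics.KineticTheory.HeatConduction.PhaseSpace N), (∀ (N : ℕ) (T_L T_R : ℝ), 0 < T_L → 0 < T_R → (Literature.MathematicalPhysics.KineticTheory.HeatConduction.pinnedChain ω₂ lam β γ).IsSteadyState N T_L T_R (μ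 N T_L T_R)) → ∀ T : ℝ, 0 < T → ∀ D : ℕ → ℝ, (∀ N : ℕ, Filter.Tendsto (fun δ : ℝ => (Literature.MathematicalPhysics.KineticTheory.HeatConduction.pinnedChain ω₂ lam β γ).totalCurrent (μ N (T + δ / 2) (T - δ / 2)) / δ) (nhdsWithin 0 {(0 : ℝ)}ᶜ) (nhds (D N))) → BddAbove (Set.range fun N => |D N|)

-- `BoundedResponseGlue` holds: proved by `Summit.AtomisticToContinuum.FouriersLaw.Theorems.boundedResponseGlue_proof` @ 41697722dadc (its module imports this route file, so no `_holds` link can be stated here).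

/-- item stmt-AtomisticToContinuum-12015 · support · rank 9 · closed · proved by Summit.AtomisticToContinuum.FouriersLaw.Theorems.transferKernelPositivity_contactIdentity_proof @ 67c83304fa60 (prover) · by planner
sources: BonettoLebowitzReyBellet2000, KunduDharNarayan2009, LepriLiviPoliti2003, AokiKusnezov2001
[support] [theorem-grade at fixed N; 'conductance = corner'; calibration, not a hypothesis of
`closes`] under uniqueness, for N ≥ 2, if θ₀, θ₁ are the profile limits at the contact sites 0 and
N−1 and d = D_N, then d = γ(N−1)(1/2 − θ₀) = γ(N−1)(θ₁ + 1/2). Content: stationarity applied to the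
contact energies h_0 = p_0²/2 + U(q_0) + ½V(q_1 − q_0) gives ⟨j_0⟩ = γ(T_L − ⟨p_0²⟩) (mirror
identity at N−1), all bond currents agree, and μ_{N,T,T} = Gibbs gives ⟨p_0²⟩ = T at δ = 0; needs
the weak Fokker–Planck identity for polynomially growing test functions (cutoff argument with the
exponential moments of CEHR2018 Thm 2.13). It fixes every sign convention (θ_N(0) < 1/2 ⟺ D_N > 0;
Passivity at the contacts ⟺ 0 ≤ D_N ≤ γ(N−1)) and is the finite-N corner formula of the card;
verified to 1e−12 on the harmonic chain by the gen-0 planner's Lyapunov solve (N ≤ 11). [difficulty: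
M] -/
@[route_item "route-AtomisticToContinuum-TransferKernelPositivity"]
def ContactIdentity : Prop :=
  ∀ ω₂ lam β γ : ℝ, 0 < ω₂ → 0 < lam → 0 < β → 0 < γ → (∀ (N : ℕ) (T_L T_R : ℝ), 0 < T_L → 0 < T_R → ∀ μ ν : MeasureTheory.Measure (Literature.MathematicalPhysics.KineticTheory.HeatConduction.PhaseSpace N), (Literature.MathematicalPhysics.KineticTheory.HeatConduction.pinnedChain ω₂ lam β γ).IsSteadyState N T_L T_R μ → (Literature.MathematicalPhysics.KineticTheory.HeatConduction.pinnedChain ω₂ lam β γ).IsSteadyState N T_L T_R ν → μ = ν) → ∀ μ : (N : ℕ) → ℝ → ℝ → MeasureTheory.Measure (Literature.MathematicalPhysics.KineticTheory.HeatConduction.PhaseSpace N), (∀ (N : ℕ) (T_L T_R : ℝ), 0 < T_L → 0 < T_R → (Literature.MathematicalPhysics.KineticTheory.HeatConduction.pinnedChain ω₂ lam β γ).IsSteadyState N T_L T_R (μ N T_L T_R)) → ∀ T : ℝ, 0 < T → ∀ (N : ℕ) (hN : 2 ≤ N) (θ₀ θ₁ d : ℝ), Filter.Tendsto (fun δ :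 ℝ => ((∫ x, (x.2 (⟨0, by omega⟩ : Fin N)) ^ 2 ∂(μ N (T + δ / 2) (T - δ / 2))) - ∫ x, (x.2 (⟨0, by omega⟩ : Fin N)) ^ 2 ∂(μ N T T)) / δ) (nhdsWithin 0 {(0 : ℝ)}ᶜ) (nhds θ₀) → Filter.Tendsto (fun δ : ℝ => ((∫ x, (x.2 (⟨N - 1, by omega⟩ : Fin N)) ^ 2 ∂(μ N (T + δ / 2) (T - δ / 2))) - ∫ x, (x.2 (⟨N - 1, by omega⟩ : Fin N)) ^ 2 ∂(μ N T T)) / δ) (nhdsWithin 0 {(0 : ℝ)}ᶜ) (nhds θ₁) → Filter.Tendsto (fun δ : ℝ => (Literature.MathematicalPhysics.KineticTheory.HeatConduction.pinnedChain ω₂ lam β γ).totalCurrent (μ N (T + δ / 2) (T - δ / 2)) / δ) (nhdsWithin 0 {(0 : ℝ)}ᶜ) (nhds d) → d = γ * ((N : ℝ) - 1) * (1 / 2 - θ₀) ∧ d = γ * ((N : ℝ) - 1) * (θ₁ + 1 / 2)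

-- `ContactIdentity` holds: proved by `Summit.AtomisticToContinuum.FouriersLaw.Theorems.transferKernelPositivity_contactIdentity_proof` @ 67c83304fa60 (its module imports this route file, so no `_holds` link can be stated here).

/-- item stmt-AtomisticToContinuum-9900 · support · rank 9 · closed · proved by Summit.AtomisticToContinuum.FouriersLaw.Theorems.pinnedSteadyStateExists_proof @ 192d41102e52 (prover) · by planner
sources: CuneoEckmannHairerReyBellet2018, Carmona2007
[support] CLAUSE (i) EXISTENCE FOR THE CONJUNCT'S CHAIN (route-repair 2026-08-15, cone bookkeeping;
provable now; kind support, rank 9): for pinnedChain ω₂ lam β γ with ω₂, lam, β, γ > 0, every N and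
all T_L, T_R > 0 there is a weak (Fokker–Planck) steady state (OscillatorChain.IsSteadyState).
PROVED in tree:
Literature.MathematicalPhysics.KineticTheory.HeatConduction.pinnedChain_exists_isSteadyState
(LangevinChainNESSHolds.lean; the discharged fact CuneoEckmannHairerReyBellet2018_pinnedChain for N
≥ 1 + OscillatorChain.isSteadyState_zero for N = 0) — a Theorems file importing the route file +
LangevinChainNESSHolds closes it in one line (evidence file attached:
PinnedSteadyStateExistsProof.lean, rc 0, axioms propext/Classical.choice/Quot.sound). WHY AN ITEM:
it lets the deciding theorem 'closes' take clause (i) existence as a hypothesis, so that the Theses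
file can drop the import Literature.MathematicalPhysics.KineticTheory.LangevinChainNESSHolds
(≈55-module Langevin-SDE cone with the two undischarged Kolmogorov–Chentsov Hölder facts) — the
pending route-repair edit (imports := [InfiniteChainDynamics], closes re-proved, Assembly restated;
package attached as evidence to the route -/
@[route_item "route-AtomisticToContinuum-TransferKernelPositivity", crux]
def PinnedSteadyStateExists : Prop :=
  ∀ ω₂ lam β γ : ℝ, 0 < ω₂ → 0 < lam → 0 < β → 0 < γ → ∀ (N : ℕ) (T_L T_R : ℝ), 0 < T_L → 0 < T_R → ∃ μ : MeasureTheory.Measure (Literature.MathematicalPhysics.KineticTheory.HeatConduction.PhaseSpace N), (Literature.MathematicalPhysics.KineticTheory.HeatConduction.pinnedChain ω₂ lam β γ).IsSteadyState N T_L T_R μ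

/-- `PinnedSteadyStateExists` holds: proved by `Summit.AtomisticToContinuum.FouriersLaw.Theorems.pinnedSteadyStateExists_proof` @ 192d41102e52. -/
theorem PinnedSteadyStateExists_holds : PinnedSteadyStateExists := _root_.Summit.AtomisticToContinuum.FouriersLaw.Theorems.pinnedSteadyStateExists_proof

/-- item stmt-AtomisticToContinuum-12016 · assembly · rank 1 · open · by planner
sources: BonettoLebowitzReyBellet2000
[assembly] NessUnique → PinnedSteadyStateExists → FiniteResponseOfUnique → FiniteResponseProfile →
Passivity → MonotoneProfile → TPGlue → LocalOhm → BoundedResponseGlue → BoundedResponseConverges →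
FouriersLaw (the sub-problem Statement decl `FouriersLaw` by name; literally the type of `closes`). -/
@[route_item "route-AtomisticToContinuum-TransferKernelPositivity"]
def Assembly : Prop :=
  NessUnique → PinnedSteadyStateExists → FiniteResponseOfUnique → FiniteResponseProfile → Passivity → MonotoneProfile → TPGlue → LocalOhm → BoundedResponseGlue → BoundedResponseConverges → FouriersLaw

/-! D-0027 §2.1 — DECIDING THEOREM (planner-authored via `route open/edit --closes-file`; by planner-plancard-AtomisticToContinuum-Fourier-6c9f62e6-g2-0 2026-08-15T18:47:48Z):
its hypotheses are this route's items and its conclusion the sub-problem Statement (glue_lint), and it elaborates with this file. -/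

@[closes "route-AtomisticToContinuum-TransferKernelPositivity"] theorem closes (hU : NessUnique) (hEx : PinnedSteadyStateExists) (hFR : FiniteResponseOfUnique)
    (hFRP : FiniteResponseProfile) (hP : Passivity) (hM : MonotoneProfile) (hTP : TPGlue)
    (hLO : LocalOhm) (hBRG : BoundedResponseGlue) (hBRC : BoundedResponseConverges) :
    FouriersLaw := by
  -- D-0027 §2.1 deciding theorem. clause (i): existence (PinnedSteadyStateExists) + uniqueness (NessUnique);
  -- clause (ii): along the canonical steady-state family, FiniteResponseOfUnique gives the response
  -- coefficients D_N(T); the sign-regularity engine Passivity + MonotoneProfile gives BVProfile (TPGlue);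
  -- LocalOhm × BV gives boundedness of (|D_N|)_N (BoundedResponseGlue); BoundedResponseConverges turns
  -- boundedness into D_N → k(T) > 0 =: κ(T); any other steady-state family agrees with the canonical one
  -- at positive temperatures (uniqueness), hence has the same difference quotients near δ = 0.
  intro ω₂ lam β γ hω hl hβ hγ
  have huniq := hU ω₂ lam β γ hω hl hβ hγ
  have hBV : BVProfile := hTP hP hM
  have hBdd := hBRG hLO hBV hFRP ω₂ lam β γ hω hl hβ hγ huniq
  refine ⟨fun N T_L T_R hL hR => ?_, ?_⟩
  · obtain ⟨μ, hμ⟩ := hEx ω₂ lam β γ hω hl hβ hγ N T_L T_R hL hR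
    exact ⟨μ, hμ, fun ν hν => huniq N T_L T_R hL hR ν μ hν hμ⟩
  · -- the canonical family (junk `0` at non-positive temperatures)
    have hex : ∀ (N : ℕ) (T_L T_R : ℝ), 0 < T_L → 0 < T_R →
        ∃ μ : MeasureTheory.Measure (Literature.MathematicalPhysics.KineticTheory.HeatConduction.PhaseSpace N),
          (Literature.MathematicalPhysics.KineticTheory.HeatConduction.pinnedChain ω₂ lam β γ).IsSteadyState N T_L T_R μ :=
      fun N T_L T_R hL hR => hEx ω₂ lam β γ hω hl hβ hγ N T_L T_R hL hR
    choose μ0 hμ0 using hex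
    let fam : (N : ℕ) → ℝ → ℝ →
        MeasureTheory.Measure (Literature.MathematicalPhysics.KineticTheory.HeatConduction.PhaseSpace N) :=
      fun N a b => if hab : 0 < a ∧ 0 < b then μ0 N a b hab.1 hab.2 else 0
    have hfam : ∀ (N : ℕ) (T_L T_R : ℝ), 0 < T_L → 0 < T_R →
        (Literature.MathematicalPhysics.KineticTheory.HeatConduction.pinnedChain ω₂ lam β γ).IsSteadyState N T_L T_R
          (fam N T_L T_R) := by
      intro N a b ha hb
      simp only [fam, dif_pos (And.intro ha hb)]
      exact hμ0 N a b ha hb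
    -- response coefficients along the canonical family and their positive limits
    have hD : ∀ T : ℝ, 0 < T → ∃ D : ℕ → ℝ,
        (∀ N : ℕ, Filter.Tendsto (fun δ : ℝ =>
          (Literature.MathematicalPhysics.KineticTheory.HeatConduction.pinnedChain ω₂ lam β γ).totalCurrent
            (fam N (T + δ / 2) (T - δ / 2)) / δ) (nhdsWithin 0 {(0 : ℝ)}ᶜ) (nhds (D N))) ∧
        ∃ k : ℝ, 0 < k ∧ Filter.Tendsto D Filter.atTop (nhds k) := by
      intro T hT
      choose D hD using hFR ω₂ lam β γ hω hl hβ hγ huniq fam hfam T hT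
      exact ⟨D, hD, hBRC ω₂ lam β γ hω hl hβ hγ huniq fam hfam T hT D hD (hBdd fam hfam T hT D hD)⟩
    choose D hDlim k hk hDk using hD
    refine ⟨fun T => if hT : 0 < T then k T hT else 1, fun T hT => ?_, fun μ hμ T hT => ?_⟩
    · simp only [dif_pos hT]
      exact hk T hT
    · refine ⟨D T hT, fun N => ?_, ?_⟩
      · -- the given family agrees with the canonical one once `T ± δ/2 > 0`
        have heq : ∀ᶠ δ in nhdsWithin (0 : ℝ) {(0 : ℝ)}ᶜ,
            (Literature.MathematicalPhysics.KineticTheory.HeatConduction.pinnedChain ω₂ lam β γ).totalCurrent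
                (fam N (T + δ / 2) (T - δ / 2)) / δ =
              (Literature.MathematicalPhysics.KineticTheory.HeatConduction.pinnedChain ω₂ lam β γ).totalCurrent
                (μ N (T + δ / 2) (T - δ / 2)) / δ := by
          have h2 : ∀ᶠ δ in nhds (0 : ℝ), δ < 2 * T := eventually_lt_nhds (by linarith)
          have h2' : ∀ᶠ δ in nhds (0 : ℝ), -(2 * T) < δ := eventually_gt_nhds (by linarith)
          filter_upwards [mem_nhdsWithin_of_mem_nhds h2, mem_nhdsWithin_of_mem_nhds h2'] with δ hlt hgt
          have ha : 0 < T + δ / 2 := by linarith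
          have hb : 0 < T - δ / 2 := by linarith
          rw [huniq N _ _ ha hb _ _ (hfam N _ _ ha hb) (hμ N _ _ ha hb)]
        exact (hDlim T hT N).congr' heq
      · simp only [dif_pos hT]
        exact hDk T hT

end Summit.AtomisticToContinuum.FouriersLaw.Theses.TransferKernelPositivity
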